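import Literature.AlgebraicGeometry.Motives.HodgeLieWeightOneGrading
import HarnessLib

/-!
# The `ad(2P − 1)`-grading of the Hodge Lie algebra in weight one, II: conjugation symmetry `dim 𝔤⁺ = dim 𝔤⁻`,
# the Hodge operator and the root vectors `E_X`, `F_X`, and the dichotomy `dim 𝔤⁺ ∈ {1, 2}` at `dim 𝔥 = 6`

Family `hodge`, layer `Literature/AlgebraicGeometry/Motives`; THEOREMS ONLY (no definition, no named fact; D-0026).
Sequel of `Motives/HodgeLieWeightOneGrading` (lane MT-RANK-SEVEN-SIMPLE of the cell `pub-hodgecm2`, seat `b27`):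
same setting (`H` of weight `1`, graded basis `e` with degrees in `{0,1}`, `P = gradingEnd e deg`, `𝔤 = 𝔥_ℂ`,
`𝔤⁺ = 𝔤 ⊓ Eig₁(ad P)`, `𝔤⁻ = 𝔤 ⊓ Eig₋₁(ad P)`, `𝔤⁰ = 𝔤 ⊓ Eig₀(ad P)`).

* §3 `conjOp_projE`, `conjOp_grading` — `conj ∘ (P Y (1−P)) ∘ conj = (1−P) Ȳ P`: conjugation preserves `Eig₀` and
  exchanges `Eig₁`, `Eig₋₁`; `finrank_le_of_conjOp_mapsTo` — `dim A ≤ dim B` whenever conjugation maps `A` into `B`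
  (the conjugates of a basis stay linearly independent); **`finrank_gradingPlus_eq_gradingMinus`: `dim 𝔤⁺ = dim 𝔤⁻`**.
* §4 `theta_mem_gradingZero`, `projE_mem_gradingPlus` — `2P − 1 ∈ 𝔤⁰`; `E_X = P X_ℂ (1−P) ∈ 𝔤⁺` and
  `F_X = (1−P) X_ℂ P ∈ 𝔤⁻`, non-zero for rational `X ∈ 𝔥 ∖ End_Hdg(V)`; **`finrank_grading_of_finrank_eq_six`** — if
  `dim_ℚ 𝔥 = 6` and `𝔥 ⊄ End_Hdg(V)` then `(dim 𝔤⁺, dim 𝔤⁻, dim 𝔤⁰) = (1, 1, 4)` (type-III position) or `(2, 2, 2)`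
  (`Res_{K/ℚ} SL₂` position): `6 = 2·dim 𝔤⁺ + dim 𝔤⁰` with `dim 𝔤⁺, dim 𝔤⁰ ≥ 1`.
* §5 `plusLine_of_finrank_gradingPlus_eq_one` — `dim 𝔤⁺ = 1` (resp. `dim 𝔤⁻ = 1`) gives hypothesis `(h⁺)` (resp.
  `(h⁻)`) of `Motives/HodgeLieWeightOnePlusLine`: every `P Y (1−P)`, `Y ∈ 𝔤`, is a multiple of `E_X` — so with
  `𝔷 = 0` one is in the type-III position `E F = αP`, `F E = α(1 − P)`
  (`projE_mul_projF_eq_smul_of_plusLine_of_center_eq_bot`).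

The case `dim 𝔤⁺ = 2` (two commuting `𝔰𝔩₂` over `ℂ`) is the subject of `Motives/HodgeLieWeightOneGradingTwo`.

## References

* [Deligne1982HodgeCycles] P. Deligne, *Hodge cycles on abelian varieties*, LNM 900 (1982), I §3 (proof of Prop. 3.4,
  3.6: the grading of `Lie MT_ℂ` by `ad μ`; real structure and complex conjugation).
* [MoonenZarhin1999LowDim] B. Moonen, Yu. Zarhin, *Hodge classes on abelian varieties of low dimension*, Math. Ann. 315
  (1999), §2 (Hodge group, `Hg ⊆ Sp(ψ)`, (2.3): the list of Hodge groups of simple abelian fourfolds).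
* [Huybrechts2016K3] D. Huybrechts, *Lectures on K3 Surfaces* (2016), §3.3.4 (p. 66).
-/

noncomputable section

open scoped TensorProduct

namespace Literature.AlgebraicGeometry.Motives

universe u

namespace HodgeStructure

open ProjectorBlocks Literature.RepresentationTheory.GeneralLinear

variable {V : Type u} [AddCommGroup V] [Module ℚ V] [Module.Finite ℚ V] [HodgeTensorFacts.{u, u}] {n : ℤ}
  {S : Type u} [Fintype S] [DecidableEq S] {deg : S → ℤ}

/-! ## §3 Conjugation exchanges `𝔤⁺` and `𝔤⁻` -/

omit [Module.Finite ℚ V] [HodgeTensorFacts.{u, u}] in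
/-- **`conj ∘ (P Y (1−P)) ∘ conj = (1−P) Ȳ P`** and **`conj ∘ ((1−P) Y P) ∘ conj = P Ȳ (1−P)`** for any `ℂ`-linear
`Y` with conjugate `Ȳ = conj ∘ Y ∘ conj` (weight `1`: `conj ∘ P = (1 − P) ∘ conj`). [cite: Deligne1982HodgeCycles, I §3 (proof of Prop. 3.4)] -/
theorem conjOp_projE (H : HodgeStructure V n) (hn : n = 1) (e : Module.Basis S ℂ (ℂ ⊗[ℚ] V))
    (hF : ∀ a, H.F a = Submodule.span ℂ (e '' {σ | a ≤ deg σ}))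
    (hFc : ∀ a, complexConj (H.F a) = Submodule.span ℂ (e '' {σ | deg σ ≤ n - a}))
    {Y Yb : Module.End ℂ (ℂ ⊗[ℚ] V)} (hYb : ∀ v, Yb v = conj (Y (conj v))) (v : ℂ ⊗[ℚ] V) :
    conj ((gradingEnd e deg * Y * (1 - gradingEnd e deg)) (conj v)) =
        ((1 - gradingEnd e deg) * Yb * gradingEnd e deg) v ∧
      conj (((1 - gradingEnd e deg) * Y * gradingEnd e deg) (conj v)) =
        (gradingEnd e deg * Yb * (1 - gradingEnd e deg)) v := by
  have hc1 : ∀ w, conj (gradingEnd e deg w) = (1 - gradingEnd e deg) (conj w) := fun w => by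
    rw [conj_gradingEnd_apply H hn e hF hFc, LinearMap.sub_apply, Module.End.one_apply]
  have hc2 : ∀ w, conj ((1 - gradingEnd e deg) w) = gradingEnd e deg (conj w) := fun w => by
    rw [LinearMap.sub_apply, Module.End.one_apply, map_sub, conj_gradingEnd_apply H hn e hF hFc, sub_sub_cancel]
  constructor
  · rw [Module.End.mul_apply, Module.End.mul_apply, Module.End.mul_apply, Module.End.mul_apply, hYb, hc1, hc1]
  · rw [Module.End.mul_apply, Module.End.mul_apply, Module.End.mul_apply, Module.End.mul_apply, hYb, hc2, hc2]

omit [Module.Finite ℚ V] [HodgeTensorFacts.{u, u}] in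
/-- **Conjugation preserves `Eig₀` and exchanges `Eig₁`, `Eig₋₁`** (weight `1`): if `Y = P Y (1−P)` then
`Ȳ = (1−P) Ȳ P`; if `Y = (1−P) Y P` then `Ȳ = P Ȳ (1−P)`; if `P Y = Y P` then `P Ȳ = Ȳ P`.
[cite: Deligne1982HodgeCycles, I §3 (proof of Prop. 3.4)] -/
theorem conjOp_grading (H : HodgeStructure V n) (hn : n = 1) (e : Module.Basis S ℂ (ℂ ⊗[ℚ] V))
    (hF : ∀ a, H.F a = Submodule.span ℂ (e '' {σ | a ≤ deg σ}))
    (hFc : ∀ a, complexConj (H.F a) = Submodule.span ℂ (e '' {σ | deg σ ≤ n - a}))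
    {Y Yb : Module.End ℂ (ℂ ⊗[ℚ] V)} (hYb : ∀ v, Yb v = conj (Y (conj v))) :
    (gradingEnd e deg * Y * (1 - gradingEnd e deg) = Y → (1 - gradingEnd e deg) * Yb * gradingEnd e deg = Yb) ∧
      ((1 - gradingEnd e deg) * Y * gradingEnd e deg = Y → gradingEnd e deg * Yb * (1 - gradingEnd e deg) = Yb) ∧
      (gradingEnd e deg * Y = Y * gradingEnd e deg → gradingEnd e deg * Yb = Yb * gradingEnd e deg) := by
  refine ⟨fun h => ?_, fun h => ?_, fun h => ?_⟩
  · refine LinearMap.ext fun v => ?_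
    rw [← (conjOp_projE H hn e hF hFc hYb v).1, h, ← hYb]
  · refine LinearMap.ext fun v => ?_
    rw [← (conjOp_projE H hn e hF hFc hYb v).2, h, ← hYb]
  · refine LinearMap.ext fun v => ?_
    have hc1 : ∀ w, conj (gradingEnd e deg w) = (1 - gradingEnd e deg) (conj w) := fun w => by
      rw [conj_gradingEnd_apply H hn e hF hFc, LinearMap.sub_apply, Module.End.one_apply]
    have hc2 : ∀ w, conj ((1 - gradingEnd e deg) w) = gradingEnd e deg (conj w) := fun w => by
      rw [LinearMap.sub_apply, Module.End.one_apply, map_sub, conj_gradingEnd_apply H hn e hF hFc, sub_sub_cancel]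
    have hYQ : Y * (1 - gradingEnd e deg) = (1 - gradingEnd e deg) * Y := by
      rw [mul_sub, sub_mul, mul_one, one_mul, h]
    have hYQv : ∀ x, (1 - gradingEnd e deg) (Y x) = Y ((1 - gradingEnd e deg) x) := fun x => by
      show ((1 - gradingEnd e deg) * Y) x = (Y * (1 - gradingEnd e deg)) x
      rw [hYQ]
    rw [Module.End.mul_apply, Module.End.mul_apply, hYb, hYb, hc1, ← hYQv, hc2]

omit [HodgeTensorFacts.{u, u}] [Fintype S] [DecidableEq S] in
/-- **`dim A ≤ dim B` whenever conjugation maps `A` into `B`** (`A, B` complex subspaces of `End_ℂ(V_ℂ)`): the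
conjugates of a basis of `A` are linearly independent in `B` (`conj` is antilinear and involutive).
[cite: Deligne1982HodgeCycles, I §3 (proof of Prop. 3.4)] -/
theorem finrank_le_of_conjOp_mapsTo {A B : Submodule ℂ (Module.End ℂ (ℂ ⊗[ℚ] V))}
    (hAB : ∀ Y ∈ A, ∀ Yb : Module.End ℂ (ℂ ⊗[ℚ] V), (∀ v, Yb v = conj (Y (conj v))) → Yb ∈ B) :
    Module.finrank ℂ A ≤ Module.finrank ℂ B := by
  classical
  -- a conjugation function on operators
  have hcj : ∀ Y : Module.End ℂ (ℂ ⊗[ℚ] V), ∃ Yb : Module.End ℂ (ℂ ⊗[ℚ] V), ∀ v, Yb v = conj (Y (conj v)) :=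
    exists_conjOp
  choose cj hcj using hcj
  have cj_add : ∀ Y Y', cj (Y + Y') = cj Y + cj Y' := fun Y Y' => LinearMap.ext fun v => by
    rw [hcj, LinearMap.add_apply, map_add, LinearMap.add_apply, hcj, hcj]
  have cj_smul : ∀ (c : ℂ) Y, cj (c • Y) = starRingEnd ℂ c • cj Y := fun c Y => LinearMap.ext fun v => by
    rw [hcj, LinearMap.smul_apply, conj_smul, LinearMap.smul_apply, hcj]
  have cj_zero : cj 0 = 0 := LinearMap.ext fun v => by
    rw [hcj, LinearMap.zero_apply, map_zero, LinearMap.zero_apply]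
  have cj_cj : ∀ Y, cj (cj Y) = Y := fun Y => LinearMap.ext fun v => by rw [hcj, hcj, conj_conj, conj_conj]
  have cj_sum : ∀ (k : ℕ) (f : Fin k → Module.End ℂ (ℂ ⊗[ℚ] V)), cj (∑ i, f i) = ∑ i, cj (f i) := by
    intro k f
    induction k with
    | zero => simp [cj_zero]
    | succ k ih => rw [Fin.sum_univ_castSucc, Fin.sum_univ_castSucc, cj_add, ih]
  haveI : Module.Free ℂ A := Module.Free.of_divisionRing ℂ A
  obtain ⟨b⟩ : Nonempty (Module.Basis (Fin (Module.finrank ℂ A)) ℂ A) := ⟨Module.finBasis ℂ A⟩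
  -- the conjugate family is linearly independent in the ambient space: apply `cj` to a dependence relation and
  -- read the coefficients off through `b.equivFun`
  have hli : LinearIndependent ℂ (fun i => cj (b i : Module.End ℂ (ℂ ⊗[ℚ] V))) := by
    rw [Fintype.linearIndependent_iff]
    intro g hg i
    have h2 : ∑ j, starRingEnd ℂ (g j) • (b j : Module.End ℂ (ℂ ⊗[ℚ] V)) = 0 := by
      have h := congrArg cj hg
      rw [cj_sum, cj_zero] at h
      simpa only [cj_smul, cj_cj] using h
    have h3 : ((b.equivFun.symm (fun j => starRingEnd ℂ (g j)) : A) : Module.End ℂ (ℂ ⊗[ℚ] V)) = 0 := by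
      rw [Module.Basis.equivFun_symm_apply, Submodule.coe_sum]
      simpa only [Submodule.coe_smul] using h2
    have h4 : (fun j => starRingEnd ℂ (g j)) = 0 := by
      have h := congrArg b.equivFun (Subtype.ext h3 : b.equivFun.symm _ = 0)
      rwa [LinearEquiv.apply_symm_apply, map_zero] at h
    simpa using congrFun h4 i
  have hcard := finrank_span_eq_card hli
  rw [Fintype.card_fin] at hcard
  rw [← hcard]
  exact Submodule.finrank_mono (Submodule.span_le.2 (Set.range_subset_iff.2 fun i => hAB _ (b i).2 _ (hcj _)))

/-- **`dim 𝔤⁺ = dim 𝔤⁻`** for the `ad(2P−1)`-grading of `𝔤 = 𝔥_ℂ` in weight one: conjugation is an antilinear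
bijection of `𝔤` (`conjOp_mem_spanC`) exchanging `Eig₁` and `Eig₋₁` (`conjOp_grading`).
[cite: Deligne1982HodgeCycles, I §3 (proof of Prop. 3.4)] [cite: MoonenZarhin1999LowDim, §2] -/
theorem finrank_gradingPlus_eq_gradingMinus (H : HodgeStructure V n) (hn : n = 1)
    (e : Module.Basis S ℂ (ℂ ⊗[ℚ] V)) (hF : ∀ a, H.F a = Submodule.span ℂ (e '' {σ | a ≤ deg σ}))
    (hFc : ∀ a, complexConj (H.F a) = Submodule.span ℂ (e '' {σ | deg σ ≤ n - a}))
    (hdeg : ∀ σ, deg σ = 0 ∨ deg σ = 1) :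
    Module.finrank ℂ (H.hodgeLieC ⊓ Module.End.eigenspace
        (LinearMap.mulLeft ℂ (gradingEnd e deg) - LinearMap.mulRight ℂ (gradingEnd e deg)) 1 : Submodule ℂ _) =
      Module.finrank ℂ (H.hodgeLieC ⊓ Module.End.eigenspace
        (LinearMap.mulLeft ℂ (gradingEnd e deg) - LinearMap.mulRight ℂ (gradingEnd e deg)) (-1) :
          Submodule ℂ _) := by
  have hPP := gradingEnd_mul_gradingEnd_of_deg e hdeg
  have hconj : ∀ Y ∈ H.hodgeLieC, ∀ Yb : Module.End ℂ (ℂ ⊗[ℚ] V), (∀ v, Yb v = conj (Y (conj v))) →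
      Yb ∈ H.hodgeLieC := by
    intro Y hY Yb hYb
    rw [hodgeLieC_eq_spanC] at hY ⊢
    exact conjOp_mem_spanC hY hYb
  apply le_antisymm
  · refine finrank_le_of_conjOp_mapsTo fun Y ⟨hY, hY1⟩ Yb hYb => ⟨hconj Y hY Yb hYb, ?_⟩
    rw [SetLike.mem_coe, mem_eigenspace_adP_one_iff hPP] at hY1
    rw [SetLike.mem_coe, mem_eigenspace_adP_neg_one_iff hPP]
    exact (conjOp_grading H hn e hF hFc hYb).1 hY1
  · refine finrank_le_of_conjOp_mapsTo fun Y ⟨hY, hY1⟩ Yb hYb => ⟨hconj Y hY Yb hYb, ?_⟩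
    rw [SetLike.mem_coe, mem_eigenspace_adP_neg_one_iff hPP] at hY1
    rw [SetLike.mem_coe, mem_eigenspace_adP_one_iff hPP]
    exact (conjOp_grading H hn e hF hFc hYb).2.1 hY1

/-! ## §4 `2P − 1 ∈ 𝔤⁰`, `E_X ∈ 𝔤⁺`, `F_X ∈ 𝔤⁻`, and the dichotomy at `dim 𝔥 = 6` -/

/-- **The Hodge operator `2P − 1` lies in `𝔤⁰`** (weight `1`). [cite: Deligne1982HodgeCycles, I §3 (proof of Prop. 3.4)]
[cite: Huybrechts2016K3, §3.3.4 (p. 66)] -/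
theorem theta_mem_gradingZero (H : HodgeStructure V n) (hn : n = 1) (e : Module.Basis S ℂ (ℂ ⊗[ℚ] V))
    (hF : ∀ a, H.F a = Submodule.span ℂ (e '' {σ | a ≤ deg σ}))
    (hFc : ∀ a, complexConj (H.F a) = Submodule.span ℂ (e '' {σ | deg σ ≤ n - a})) :
    (2 : ℂ) • gradingEnd e deg - 1 ∈ (H.hodgeLieC ⊓ Module.End.eigenspace
        (LinearMap.mulLeft ℂ (gradingEnd e deg) - LinearMap.mulRight ℂ (gradingEnd e deg)) 0 : Submodule ℂ _) := by
  subst hn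
  refine ⟨?_, ?_⟩
  · have h := two_smul_gradingEnd_sub_mem_hodgeLieC H e hF hFc
    rw [Int.cast_one, one_smul] at h
    exact h
  · rw [SetLike.mem_coe, mem_eigenspace_adP_zero_iff, mul_sub, sub_mul, mul_smul_comm, smul_mul_assoc, mul_one,
      one_mul]

/-- **`E_X = P X_ℂ (1−P) ∈ 𝔤⁺` and `F_X = (1−P) X_ℂ P ∈ 𝔤⁻` for rational `X ∈ 𝔥`**, both non-zero when
`X ∉ End_Hdg(V)` (weight `1`, degrees in `{0,1}`). [cite: Deligne1982HodgeCycles, I §3 (proof of Prop. 3.4)]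
[cite: MoonenZarhin1999LowDim, §2] -/
theorem projE_mem_gradingPlus (H : HodgeStructure V n) (hn : n = 1) (e : Module.Basis S ℂ (ℂ ⊗[ℚ] V))
    (hF : ∀ a, H.F a = Submodule.span ℂ (e '' {σ | a ≤ deg σ}))
    (hFc : ∀ a, complexConj (H.F a) = Submodule.span ℂ (e '' {σ | deg σ ≤ n - a}))
    (hdeg : ∀ σ, deg σ = 0 ∨ deg σ = 1) {X : Module.End ℚ V} (hX : X ∈ H.hodgeLie) :
    gradingEnd e deg * X.baseChange ℂ * (1 - gradingEnd e deg) ∈ (H.hodgeLieC ⊓ Module.End.eigenspace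
        (LinearMap.mulLeft ℂ (gradingEnd e deg) - LinearMap.mulRight ℂ (gradingEnd e deg)) 1 : Submodule ℂ _) ∧
      (1 - gradingEnd e deg) * X.baseChange ℂ * gradingEnd e deg ∈ (H.hodgeLieC ⊓ Module.End.eigenspace
        (LinearMap.mulLeft ℂ (gradingEnd e deg) - LinearMap.mulRight ℂ (gradingEnd e deg)) (-1) : Submodule ℂ _) ∧
      (X ∉ H.endAlg → gradingEnd e deg * X.baseChange ℂ * (1 - gradingEnd e deg) ≠ 0 ∧
        (1 - gradingEnd e deg) * X.baseChange ℂ * gradingEnd e deg ≠ 0) := by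
  have hPP := gradingEnd_mul_gradingEnd_of_deg e hdeg
  obtain ⟨hE, hF'⟩ := projE_mem_hodgeLieC H e hF hFc hdeg (H.baseChange_mem_hodgeLieC hX)
  obtain ⟨h1, h2, -, -⟩ := components_mem_eigenspace_adP (K := ℂ) hPP (X.baseChange ℂ)
  exact ⟨⟨hE, h1⟩, ⟨hF', h2⟩, fun hXE => projE_ne_zero_of_not_mem_endAlg H hn e hF hFc hdeg hXE⟩

/-- **The dichotomy at `dim 𝔥 = 6`**: if `dim_ℚ Lie Hg(H) = 6` and `Lie Hg(H) ⊄ End_Hdg(V)` (weight `1`, degrees in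
`{0,1}`) then `(dim 𝔤⁺, dim 𝔤⁻, dim 𝔤⁰)` is `(1, 1, 4)` (type-III position) or `(2, 2, 2)` (`Res SL₂` position):
`dim 𝔤 = 6 = 2·dim 𝔤⁺ + dim 𝔤⁰` with `dim 𝔤⁺ ≥ 1` (`E_X ≠ 0`) and `dim 𝔤⁰ ≥ 1` (`2P − 1 ≠ 0`).
[cite: Deligne1982HodgeCycles, I §3 (proof of Prop. 3.4)] [cite: MoonenZarhin1999LowDim, §2 and (2.3)] -/
theorem finrank_grading_of_finrank_eq_six (H : HodgeStructure V n) (hn : n = 1)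
    (e : Module.Basis S ℂ (ℂ ⊗[ℚ] V)) (hF : ∀ a, H.F a = Submodule.span ℂ (e '' {σ | a ≤ deg σ}))
    (hFc : ∀ a, complexConj (H.F a) = Submodule.span ℂ (e '' {σ | deg σ ≤ n - a}))
    (hdeg : ∀ σ, deg σ = 0 ∨ deg σ = 1) (h6 : Module.finrank ℚ H.hodgeLie = 6)
    (hne : ¬ H.hodgeLie ≤ Subalgebra.toSubmodule H.endAlg) :
    (Module.finrank ℂ (H.hodgeLieC ⊓ Module.End.eigenspace
          (LinearMap.mulLeft ℂ (gradingEnd e deg) - LinearMap.mulRight ℂ (gradingEnd e deg)) 1 : Submodule ℂ _) = 1 ∧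
      Module.finrank ℂ (H.hodgeLieC ⊓ Module.End.eigenspace
          (LinearMap.mulLeft ℂ (gradingEnd e deg) - LinearMap.mulRight ℂ (gradingEnd e deg)) (-1) :
            Submodule ℂ _) = 1 ∧
      Module.finrank ℂ (H.hodgeLieC ⊓ Module.End.eigenspace
          (LinearMap.mulLeft ℂ (gradingEnd e deg) - LinearMap.mulRight ℂ (gradingEnd e deg)) 0 : Submodule ℂ _) = 4) ∨
    (Module.finrank ℂ (H.hodgeLieC ⊓ Module.End.eigenspace
          (LinearMap.mulLeft ℂ (gradingEnd e deg) - LinearMap.mulRight ℂ (gradingEnd e deg)) 1 : Submodule ℂ _) = 2 ∧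
      Module.finrank ℂ (H.hodgeLieC ⊓ Module.End.eigenspace
          (LinearMap.mulLeft ℂ (gradingEnd e deg) - LinearMap.mulRight ℂ (gradingEnd e deg)) (-1) :
            Submodule ℂ _) = 2 ∧
      Module.finrank ℂ (H.hodgeLieC ⊓ Module.End.eigenspace
          (LinearMap.mulLeft ℂ (gradingEnd e deg) - LinearMap.mulRight ℂ (gradingEnd e deg)) 0 : Submodule ℂ _) = 2) := by
  obtain ⟨X, hX, hXE⟩ := SetLike.not_le_iff_exists.1 hne
  rw [Subalgebra.mem_toSubmodule] at hXE
  have hsum := finrank_hodgeLieC_eq_grading H e hF hFc hdeg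
  rw [finrank_hodgeLieC, h6] at hsum
  have hpm := finrank_gradingPlus_eq_gradingMinus H hn e hF hFc hdeg
  obtain ⟨hEmem, -, hne0⟩ := projE_mem_gradingPlus H hn e hF hFc hdeg hX
  obtain ⟨hE0, -⟩ := hne0 hXE
  -- `dim 𝔤⁺ ≥ 1`
  have hp : 1 ≤ Module.finrank ℂ (H.hodgeLieC ⊓ Module.End.eigenspace
      (LinearMap.mulLeft ℂ (gradingEnd e deg) - LinearMap.mulRight ℂ (gradingEnd e deg)) 1 : Submodule ℂ _) := by
    rw [Nat.one_le_iff_ne_zero, Ne, Submodule.finrank_eq_zero]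
    intro h
    rw [h, Submodule.mem_bot] at hEmem
    exact hE0 hEmem
  -- `dim 𝔤⁰ ≥ 1`: the Hodge operator is non-zero since `E_X ≠ 0` forces `V_ℂ ≠ 0`
  have hΘ := theta_mem_gradingZero H hn e hF hFc
  have hΘ0 : (2 : ℂ) • gradingEnd e deg - 1 ≠ 0 := by
    intro h
    have hPP := gradingEnd_mul_gradingEnd_of_deg e hdeg
    have h1 : (1 : Module.End ℂ (ℂ ⊗[ℚ] V)) = 0 := by rw [← theta_mul_theta hPP, h, mul_zero]
    exact hE0 (by rw [← one_mul (gradingEnd e deg * X.baseChange ℂ * (1 - gradingEnd e deg)), h1, zero_mul])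
  have h0 : 1 ≤ Module.finrank ℂ (H.hodgeLieC ⊓ Module.End.eigenspace
      (LinearMap.mulLeft ℂ (gradingEnd e deg) - LinearMap.mulRight ℂ (gradingEnd e deg)) 0 : Submodule ℂ _) := by
    rw [Nat.one_le_iff_ne_zero, Ne, Submodule.finrank_eq_zero]
    intro h
    rw [h, Submodule.mem_bot] at hΘ
    exact hΘ0 hΘ
  omega

/-! ## §5 `dim 𝔤⁺ = 1`: the hypotheses of `HodgeLieWeightOnePlusLine` -/

/-- **If `dim 𝔤⁺ = 1` then every `P Y (1−P)`, `Y ∈ 𝔤`, is a multiple of `E_X`**, and if `dim 𝔤⁻ = 1` every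
`(1−P) Y P` is a multiple of `F_X` (`X ∈ 𝔥 ∖ End_Hdg(V)` rational): the hypotheses `(h⁺)`, `(h⁻)` of
`exists_smul_of_plusLine` / `projE_mul_projF_eq_smul_of_plusLine_of_center_eq_bot` — so with `𝔷 = 0` one gets
`E F = αP`, `F E = α(1 − P)` (the type-III position `V_ℂ ≅ std ⊗ W`). [cite: MoonenZarhin1999LowDim, §2 and (2.3)]
[cite: Deligne1982HodgeCycles, I §3 (proof of Prop. 3.4)] -/
theorem plusLine_of_finrank_gradingPlus_eq_one (H : HodgeStructure V n) (hn : n = 1)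
    (e : Module.Basis S ℂ (ℂ ⊗[ℚ] V)) (hF : ∀ a, H.F a = Submodule.span ℂ (e '' {σ | a ≤ deg σ}))
    (hFc : ∀ a, complexConj (H.F a) = Submodule.span ℂ (e '' {σ | deg σ ≤ n - a}))
    (hdeg : ∀ σ, deg σ = 0 ∨ deg σ = 1) {X : Module.End ℚ V} (hX : X ∈ H.hodgeLie) (hXE : X ∉ H.endAlg) :
    (Module.finrank ℂ (H.hodgeLieC ⊓ Module.End.eigenspace
        (LinearMap.mulLeft ℂ (gradingEnd e deg) - LinearMap.mulRight ℂ (gradingEnd e deg)) 1 : Submodule ℂ _) = 1 →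
      ∀ Y ∈ H.hodgeLieC, ∃ c : ℂ,
        gradingEnd e deg * Y * (1 - gradingEnd e deg) = c • (gradingEnd e deg * X.baseChange ℂ * (1 - gradingEnd e deg))) ∧
    (Module.finrank ℂ (H.hodgeLieC ⊓ Module.End.eigenspace
        (LinearMap.mulLeft ℂ (gradingEnd e deg) - LinearMap.mulRight ℂ (gradingEnd e deg)) (-1) : Submodule ℂ _) = 1 →
      ∀ Y ∈ H.hodgeLieC, ∃ c : ℂ,
        (1 - gradingEnd e deg) * Y * gradingEnd e deg = c • ((1 - gradingEnd e deg) * X.baseChange ℂ * gradingEnd e deg)) := by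
  have hPP := gradingEnd_mul_gradingEnd_of_deg e hdeg
  obtain ⟨hEmem, hFmem, hne0⟩ := projE_mem_gradingPlus H hn e hF hFc hdeg hX
  obtain ⟨hE0, hF0⟩ := hne0 hXE
  set Gp : Submodule ℂ (Module.End ℂ (ℂ ⊗[ℚ] V)) := H.hodgeLieC ⊓ Module.End.eigenspace
    (LinearMap.mulLeft ℂ (gradingEnd e deg) - LinearMap.mulRight ℂ (gradingEnd e deg)) 1 with hGp
  set Gm : Submodule ℂ (Module.End ℂ (ℂ ⊗[ℚ] V)) := H.hodgeLieC ⊓ Module.End.eigenspace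
    (LinearMap.mulLeft ℂ (gradingEnd e deg) - LinearMap.mulRight ℂ (gradingEnd e deg)) (-1) with hGm
  constructor
  · intro h1 Y hY
    obtain ⟨gE, -, -⟩ := hodgeLieC_components_mem H e hF hFc hdeg hY
    obtain ⟨g1, -, -, -⟩ := components_mem_eigenspace_adP (K := ℂ) hPP Y
    have hv : (⟨gradingEnd e deg * X.baseChange ℂ * (1 - gradingEnd e deg), hEmem⟩ : Gp) ≠ 0 := by
      intro h; apply hE0; simpa using congrArg Subtype.val h
    have key := (finrank_eq_one_iff_of_nonzero' (K := ℂ) (V := Gp) _ hv).1 h1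
    obtain ⟨c, hc⟩ := key ⟨_, ⟨gE, g1⟩⟩
    exact ⟨c, by simpa using (congrArg Subtype.val hc).symm⟩
  · intro h1 Y hY
    obtain ⟨-, gF, -⟩ := hodgeLieC_components_mem H e hF hFc hdeg hY
    obtain ⟨-, g2, -, -⟩ := components_mem_eigenspace_adP (K := ℂ) hPP Y
    have hv : (⟨(1 - gradingEnd e deg) * X.baseChange ℂ * gradingEnd e deg, hFmem⟩ : Gm) ≠ 0 := by
      intro h; apply hF0; simpa using congrArg Subtype.val h
    have key := (finrank_eq_one_iff_of_nonzero' (K := ℂ) (V := Gm) _ hv).1 h1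
    obtain ⟨c, hc⟩ := key ⟨_, ⟨gF, g2⟩⟩
    exact ⟨c, by simpa using (congrArg Subtype.val hc).symm⟩

end HodgeStructure

end Literature.AlgebraicGeometry.Motives

end
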